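import Literature.NumberTheory.GaloisCohomology.TateEulerCharacteristicTCFiniteQuotient
import Literature.NumberTheory.GaloisCohomology.RestrictedRamificationEulerCharacteristicKilledByPrime
import Literature.NumberTheory.GaloisCohomology.TateGlobalEulerCharacteristicOfPrimaryTC
import Literature.NumberTheory.GaloisRepresentations.RestrictedRamificationInflationTwo
import Literature.NumberTheory.GaloisRepresentations.RestrictedRamificationKummer
import HarnessLib

/-!
# Tate's global Euler–Poincaré characteristic formula at a TOTALLY COMPLEX `K`, from the cyclic
# subquotients of `G_S` of order prime to `p` (Milne ADT I Thm. 5.1: the assembly of the reduction)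

Topic `NumberTheory/GaloisCohomology`; namespace `Literature.NumberTheory.GaloisCohomology`.
THEOREMS ONLY (no definition, no named fact, no `sorry`, no instance; D-0026).  Lane «TATE-EPC-TC»
of cell `bsd-eis` (road memo evidence #54 on stmt-BirchSwinnertonDyer-19032), brick B9 (assembly),
last part.

Milne, *Arithmetic Duality Theorems* (2006), I Thm. 5.1 with footnote 13: for a totally complex
number field `K`, a finite set `S ⊇ S_∞` of places and a finite `G_S`-module `M` whose order is an
`S`-unit, `#H⁰(G_S, M)·#H²(G_S, M)·#M^{r₂} = #H¹(G_S, M)`.  The proof (pp. 69–70) reduces, by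
additivity (Lemma 5.3), to `M` killed by one prime `p`; regards such an `M` as a module over the
finite group `Ḡ = Gal(L/K) = G_S ⧸ W` for an open normal `W` fixing `M` and `μ_p`; and by Artin
induction (Lemma 2.10) and the `p`-group filtration reduces to `Ḡ` "a cyclic group of order prime to
`p`", where the formula is a computation with the `S`-units and the `S`-ideal classes of `L`.  This
file assembles the tree's versions of these steps —
`tateGlobalEulerPoincareCharacteristic_of_isTotallyComplex_of_forall_prime` (B0, reduction to
`p`-primary `M`), `eulerTC_of_eulerTC_killedBy` (-w3 g15, reduction to `pM = 0`),
`eulerChar_inflate_eq_zero_of_base` (Artin induction + `p`-part step + Shapiro) — into: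

> **`tateGlobalEulerPoincareCharacteristic_of_isTotallyComplex_of_base`**: for `K` totally complex,
> GRANTED `finite_restrictedCohomology K` (Harari Cor. 17.17) and the CYCLIC-PRIME-TO-`p` BASE CASE
> (BASE_K, below — the statement brick B8 of the lane proves from Kummer theory on the `S`-units),
> the named fact `tateGlobalEulerPoincareCharacteristic K` holds.

BASE_K (binder-exact, `U := C.comap (QuotientGroup.mk' W)`, `Hⁿ(U, M) := continuousCohomology n`
of `(((ContinuousRep.ofDiscrete σ).restrict (ContinuousMonoidHom.quotientMk W)).restrict
(subgroupIncl U))`): for every finite `S ⊇ S_p`, every continuous `G_S`-module structure `ρ₀` on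
`μ_p` lifting the Galois action, every OPEN normal `W ⊴ G_S` acting trivially on `μ_p` through `ρ₀`,
every CYCLIC `C ≤ G_S ⧸ W` of order PRIME TO `p`, and every finite `ℤ[G_S ⧸ W]`-module `σ` on `M`
killed by `p`:
`v_p #H⁰(U, M) − v_p #H¹(U, M) + v_p #H²(U, M) + ([G_S : U]·r₂(K))·v_p #M = 0`.

HONEST FRAMING: a reduction; Tate's formula is proved here only relative to BASE_K and Cor. 17.17.

## References
* J. S. Milne, *Arithmetic Duality Theorems*, 2nd ed. (2006), I §5 Thm. 5.1 (pp. 67–70) with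
  footnote 13, Lemma 2.10 (p. 32). [MilneADT2006]
* J. Neukirch, A. Schmidt, K. Wingberg, *Cohomology of Number Fields*, 2nd ed. (2008), (8.7.4)
  (proof). [NeukirchSchmidtWingberg2008]
* D. Harari, *Galois Cohomology and Class Field Theory* (2020), Cor. 17.17, Def. 15.36. [Harari2020]
-/

noncomputable section

open CategoryTheory Function NumberField Field IsDedekindDomain
open scoped NumberField TensorProduct Pointwise

namespace Literature.NumberTheory.GaloisCohomology

open Literature.NumberTheory.GaloisRepresentations
open Literature.NumberTheory.GaloisRepresentations.DiscreteGaloisModule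
  (restrictedCohomology inflate mu MuCarrier mu_apply_apply)
open Literature.RepresentationTheory.FiniteGroups
open _root_.TopRep _root_.ContRepresentation _root_.ContinuousCohomology

variable {K : Type} [Field K] [NumberField K]

/-! ### §1. Open kernels; the descent of a finite `G_S`-module to a finite quotient -/

/-- The kernel of a continuous action on a FINITE discrete module is open (a finite intersection of
stabilisers). [cite: SerreGaloisCohomology1997, I §2.1] -/
private theorem isOpen_ker_toRepresentation {G : Type} [Group G] [TopologicalSpace G]
    [IsTopologicalGroup G] {A : Type} [AddCommGroup A] [TopologicalSpace A] [DiscreteTopology A]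
    [Finite A] (τ : ContinuousRep G ℤ A) : IsOpen (τ.toRepresentation.ker : Set G) := by
  have h : (τ.toRepresentation.ker : Set G) = ⋂ a : A, {g | τ g a = a} := by
    ext g
    simp only [SetLike.mem_coe, MonoidHom.mem_ker, Set.mem_iInter, Set.mem_setOf_eq]
    constructor
    · intro hg a
      rw [← ContinuousRep.toRepresentation_apply, hg, Module.End.one_apply]
    · intro hg
      exact LinearMap.ext fun a => hg a
  rw [h]
  exact isOpen_iInter_of_finite fun a => τ.isOpen_setOf_apply_eq a

/-! ### §2. Tate's identity for `M` killed by `p`, from BASE -/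

section KilledBy

variable [IsTotallyComplex K] {S : Set (HeightOneSpectrum (𝓞 K))}

/-- **Tate's identity `#H⁰·#H²·#M^e = #H¹` for a finite `G_S`-module `M` KILLED BY `p`, from BASE**
(at `S ⊇ S_p` finite, granted `finite_restrictedCohomology K`): `M` and `μ_p` are fixed by an open
normal `W ⊴ G_S` (open kernels), `M` is the inflation of a `ℤ[G_S ⧸ W]`-module `σ`, and
`eulerChar_inflate_eq_zero_of_base` gives `χ_{p,e}(inflate π_W σ) = χ_{p,e}(M) = 0`.
[cite: MilneADT2006, I §5 Thm. 5.1 (proof, pp. 69–70)] [cite: Harari2020, Cor. 17.17 and Def. 15.36] -/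
theorem restrictedCohomology_euler_killedBy_of_base (hfinK : finite_restrictedCohomology K)
    (hSfin : S.Finite) (p : ℕ) [hp : Fact p.Prime]
    (hSp : ∀ v : HeightOneSpectrum (𝓞 K), ((p : ℕ) : 𝓞 K) ∈ v.asIdeal → v ∈ S) (e : ℕ)
    (hbase : ∀ (ρ₀ : ContinuousRep (GaloisGroupUnramifiedOutside K S) ℤ (MuCarrier K p)),
      (∀ (τ : absoluteGaloisGroup K) (v : MuCarrier K p), ρ₀ (toUnramifiedQuot K S τ) v = mu K p τ v) →
      ∀ (W : Subgroup (GaloisGroupUnramifiedOutside K S)) [W.Normal]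
        [DiscreteTopology (GaloisGroupUnramifiedOutside K S ⧸ W)],
        IsOpen (W : Set (GaloisGroupUnramifiedOutside K S)) → (∀ g ∈ W, ∀ v : MuCarrier K p, ρ₀ g v = v) →
      ∀ (C : Subgroup (GaloisGroupUnramifiedOutside K S ⧸ W))
        [Fintype ((GaloisGroupUnramifiedOutside K S ⧸ W) ⧸ C)], IsCyclic C → (Nat.card C).Coprime p →
      ∀ (M : Type) [AddCommGroup M] [TopologicalSpace M] [DiscreteTopology M] [Finite M]
        (σ : Representation ℤ (GaloisGroupUnramifiedOutside K S ⧸ W) M), (∀ m : M, (p : ℤ) • m = 0) →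
        ((padicValNat p (Nat.card (continuousCohomology 0
            (((ContinuousRep.ofDiscrete σ).restrict (ContinuousMonoidHom.quotientMk W)).restrict
              (subgroupIncl (C.comap (QuotientGroup.mk' W)))).toTopRep)) : ℤ) -
            padicValNat p (Nat.card (continuousCohomology 1
              (((ContinuousRep.ofDiscrete σ).restrict (ContinuousMonoidHom.quotientMk W)).restrict
                (subgroupIncl (C.comap (QuotientGroup.mk' W)))).toTopRep)) +
            padicValNat p (Nat.card (continuousCohomology 2
              (((ContinuousRep.ofDiscrete σ).restrict (ContinuousMonoidHom.quotientMk W)).restrict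
                (subgroupIncl (C.comap (QuotientGroup.mk' W)))).toTopRep)) +
          ((C.comap (QuotientGroup.mk' W)).index * e : ℕ) * padicValNat p (Nat.card M)) = 0)
    (M : Type) [AddCommGroup M] [TopologicalSpace M] [DiscreteTopology M] [Finite M]
    (ρ : DiscreteGaloisModule K M) (hur : GaloisRep.IsUnramifiedOutside S ρ)
    (hM : ∀ m : M, (p : ℤ) • m = 0) :
    Nat.card (restrictedCohomology ρ S 0) * Nat.card (restrictedCohomology ρ S 2) * Nat.card M ^ e =
      Nat.card (restrictedCohomology ρ S 1) := by
  -- a `G_S`-module structure on `μ_p` (`N_S` fixes `μ_p` since `S ⊇ S_p`)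
  obtain ⟨ρ₀, hρ₀, -⟩ := exists_continuousRep_galoisGroupAbove_mu S (⊤ : Subgroup (absoluteGaloisGroup K))
    (N := p) (fun n hn v => by
      apply MuCarrier.toAdditive.injective
      rw [mu_apply_apply]
      apply congrArg Additive.ofMul
      apply Subtype.ext
      rw [absoluteGaloisGroup.coe_smul_rootsOfUnity]
      exact Units.ext (smul_units_eq_self_of_mem_ramificationSubgroup (N := p) hSp _
        ((mem_rootsOfUnity _ _).1 (MuCarrier.toAdditive v).toMul.2) n hn))
  -- `M` is a `G_S`-module: descend `ρ` along `Γ_K ↠ G_S`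
  have hker : ramificationSubgroup K S ≤ ContinuousRep.ker ρ :=
    (DiscreteGaloisModule.isUnramifiedOutside_iff_ramificationSubgroup_le_ker ρ S).1 hur
  let ρS : Representation ℤ (GaloisGroupUnramifiedOutside K S) M :=
    QuotientGroup.lift (ramificationSubgroup K S) ρ.toRepresentation fun n hn =>
      (ContinuousRep.mem_ker ρ n).1 (hker hn)
  have hρS : ∀ (τ : absoluteGaloisGroup K) (m : M), ρS (toUnramifiedQuot K S τ) m = ρ τ m :=
    fun τ m => by
      change (QuotientGroup.lift (ramificationSubgroup K S) ρ.toRepresentation _ (QuotientGroup.mk τ)) m = _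
      rw [QuotientGroup.lift_mk]
      rfl
  -- a continuous structure on the descended module, to read off that its kernel is open
  let ρS' : ContinuousRep (GaloisGroupUnramifiedOutside K S) ℤ M :=
    ContinuousRep.ofStabilizerMemNhdsOne ρS fun m => by
      have hopen : IsOpen {τ : absoluteGaloisGroup K | ρ τ m = m} := ρ.isOpen_setOf_apply_eq m
      have himg : toUnramifiedQuot K S '' {τ : absoluteGaloisGroup K | ρ τ m = m} ⊆
          {g : GaloisGroupUnramifiedOutside K S | ρS g m = m} := by
        rintro _ ⟨τ, hτ, rfl⟩
        change ρS (toUnramifiedQuot K S τ) m = m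
        rw [hρS]; exact hτ
      refine Filter.mem_of_superset
        ((isOpenMap_toUnramifiedQuot K S _ hopen).mem_nhds ⟨1, ?_, map_one _⟩) himg
      change ρ 1 m = m
      rw [map_one]; rfl
  -- the open normal subgroup `W = ker ρS ⊓ ker ρ₀`
  let W : Subgroup (GaloisGroupUnramifiedOutside K S) := ρS.ker ⊓ ρ₀.toRepresentation.ker
  haveI hWn : W.Normal := Subgroup.normal_inf_normal _ _
  have hWo : IsOpen (W : Set (GaloisGroupUnramifiedOutside K S)) := by
    change IsOpen ((ρS.ker : Set (GaloisGroupUnramifiedOutside K S)) ∩ ρ₀.toRepresentation.ker)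
    exact (isOpen_ker_toRepresentation ρS').inter (isOpen_ker_toRepresentation ρ₀)
  haveI : DiscreteTopology (GaloisGroupUnramifiedOutside K S ⧸ W) := QuotientGroup.discreteTopology hWo
  have hWfix : ∀ g ∈ W, ∀ v : MuCarrier K p, ρ₀ g v = v := fun g hg v => by
    have h2 : ρ₀.toRepresentation g = 1 := MonoidHom.mem_ker.1 hg.2
    rw [← ContinuousRep.toRepresentation_apply, h2, Module.End.one_apply]
  -- `M` as a `ℤ[G_S ⧸ W]`-module
  let σ : Representation ℤ (GaloisGroupUnramifiedOutside K S ⧸ W) M :=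
    QuotientGroup.lift W ρS fun w hw => MonoidHom.mem_ker.1 hw.1
  have hσ : ∀ (g : GaloisGroupUnramifiedOutside K S) (m : M), σ (g : GaloisGroupUnramifiedOutside K S ⧸ W) m = ρS g m :=
    fun g m => by
      change (QuotientGroup.lift W ρS _ (QuotientGroup.mk g)) m = _
      rw [QuotientGroup.lift_mk]
  -- its inflation along `π_W : Γ_K ↠ G_S ↠ G_S ⧸ W` is `ρ`
  have hinf : inflate ((ContinuousMonoidHom.quotientMk W).comp (toUnramifiedQuotCont K S))
      (Representation.ofIntModule _ σ) = ρ := by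
    refine ContinuousRep.ext fun τ => LinearMap.ext fun m => ?_
    rw [DiscreteGaloisModule.inflate_apply, Representation.ofIntModule_apply]
    change σ ((toUnramifiedQuot K S τ : GaloisGroupUnramifiedOutside K S) :
      GaloisGroupUnramifiedOutside K S ⧸ W) m = ρ τ m
    rw [hσ, hρS]
  -- `χ_{p,e}(M) = 0` by the reduction to BASE, then Tate's identity
  have hχ := eulerChar_inflate_eq_zero_of_base S W hfinK hSfin p hSp hWo e
    (hbase ρ₀ hρ₀ W hWo hWfix) M σ hM
  rw [hinf] at hχ
  have hMp : IsPrimaryTorsion p M :=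
    DiscreteGaloisModule.isPrimaryTorsion_of_forall_intModule_smul_eq_zero (AddCommGroup.toIntModule M) hM
  haveI : Finite (restrictedCohomology ρ S 2) :=
    hfinK S hSfin M ρ hur (mem_of_natCard_mem_of_isPrimaryTorsion p hSp hMp) 2
  exact (restrictedCohomology_euler_iff_eulerChar_eq_zero hSfin p ρ hMp e).2 hχ

end KilledBy

/-! ### §3. Tate's global Euler–Poincaré characteristic at a totally complex `K`, from BASE -/

/-- **Milne ADT I Thm. 5.1 at a TOTALLY COMPLEX `K`, relative to the cyclic prime-to-`p` base case.**
Granted `finite_restrictedCohomology K` (Harari Cor. 17.17 — a theorem of the tree at totally complex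
`K`, brick B1c) and BASE_K (module docstring — brick B8: the `S`-unit / `S`-class-group computation
over the cyclic subquotients of `G_S` of order prime to `p`), the named fact
`tateGlobalEulerPoincareCharacteristic K` holds: reduce to `p`-primary `M` (B0,
`…_of_isTotallyComplex_of_forall_prime`), to `pM = 0` (`eulerTC_of_eulerTC_killedBy`), and apply
`restrictedCohomology_euler_killedBy_of_base`.
[cite: MilneADT2006, I §5 Thm. 5.1 (pp. 67–70) with footnote 13, Lemma 2.10 (p. 32)]
[cite: NeukirchSchmidtWingberg2008, (8.7.4) (proof)] [cite: Harari2020, Cor. 17.17] -/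
theorem tateGlobalEulerPoincareCharacteristic_of_isTotallyComplex_of_base (K : Type) [Field K]
    [NumberField K] [IsTotallyComplex K] (hfinK : finite_restrictedCohomology K)
    (hbase : ∀ (S : Set (HeightOneSpectrum (𝓞 K))), S.Finite → ∀ (p : ℕ) [Fact p.Prime],
      (∀ v : HeightOneSpectrum (𝓞 K), ((p : ℕ) : 𝓞 K) ∈ v.asIdeal → v ∈ S) →
      ∀ (ρ₀ : ContinuousRep (GaloisGroupUnramifiedOutside K S) ℤ (MuCarrier K p)),
      (∀ (τ : absoluteGaloisGroup K) (v : MuCarrier K p), ρ₀ (toUnramifiedQuot K S τ) v = mu K p τ v) →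
      ∀ (W : Subgroup (GaloisGroupUnramifiedOutside K S)) [W.Normal]
        [DiscreteTopology (GaloisGroupUnramifiedOutside K S ⧸ W)],
        IsOpen (W : Set (GaloisGroupUnramifiedOutside K S)) → (∀ g ∈ W, ∀ v : MuCarrier K p, ρ₀ g v = v) →
      ∀ (C : Subgroup (GaloisGroupUnramifiedOutside K S ⧸ W))
        [Fintype ((GaloisGroupUnramifiedOutside K S ⧸ W) ⧸ C)], IsCyclic C → (Nat.card C).Coprime p →
      ∀ (M : Type) [AddCommGroup M] [TopologicalSpace M] [DiscreteTopology M] [Finite M]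
        (σ : Representation ℤ (GaloisGroupUnramifiedOutside K S ⧸ W) M), (∀ m : M, (p : ℤ) • m = 0) →
        ((padicValNat p (Nat.card (continuousCohomology 0
            (((ContinuousRep.ofDiscrete σ).restrict (ContinuousMonoidHom.quotientMk W)).restrict
              (subgroupIncl (C.comap (QuotientGroup.mk' W)))).toTopRep)) : ℤ) -
            padicValNat p (Nat.card (continuousCohomology 1
              (((ContinuousRep.ofDiscrete σ).restrict (ContinuousMonoidHom.quotientMk W)).restrict
                (subgroupIncl (C.comap (QuotientGroup.mk' W)))).toTopRep)) +
            padicValNat p (Nat.card (continuousCohomology 2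
              (((ContinuousRep.ofDiscrete σ).restrict (ContinuousMonoidHom.quotientMk W)).restrict
                (subgroupIncl (C.comap (QuotientGroup.mk' W)))).toTopRep)) +
          ((C.comap (QuotientGroup.mk' W)).index * InfinitePlace.nrComplexPlaces K : ℕ) *
            padicValNat p (Nat.card M)) = 0) :
    tateGlobalEulerPoincareCharacteristic K :=
  tateGlobalEulerPoincareCharacteristic_of_isTotallyComplex_of_forall_prime K fun p hp => by
    haveI : Fact p.Prime := ⟨hp⟩
    exact eulerTC_of_eulerTC_killedBy p fun S hS M _ _ _ _ ρ hur hSp hM =>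
      restrictedCohomology_euler_killedBy_of_base hfinK hS p hSp (InfinitePlace.nrComplexPlaces K)
        (hbase S hS p hSp) M ρ hur hM

end Literature.NumberTheory.GaloisCohomology

end
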